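import Summits.QuantumFields.BalabanUV.T4Continuum.Spine.NE4.KingCurrencyWindow
import Summits.QuantumFields.BalabanUV.T4Continuum.Spine.NE4.KingCurrencyPointwise
import Summits.QuantumFields.BalabanUV.T4Continuum.Spine.NE4.KingCurrencyTransport

/-!
# Spine/NE4/KingCurrencyClosed — the (R51) chain in ONE theorem: POINTWISE convergence of the β-functions along histories (+ node U2's
# memory companion and AF binders) and the E-side King-route shapes ⟹ the generating functions of the runs are Cauchy in the cutoff

Cell `pub-balaban-gaps` (YM blitz G2), seat `ne4` generation 13 (unit `pub-balaban-gaps-ne4-g13`), record `HOME/ne/NE4.md` §5 census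
item (R51); capstone of `KingCurrencyPointwise` (Arzelà–Ascoli: (P) + (M) ⟹ `UniformShift ω`, `ω → 0`), `KingCurrencyWindow` (node U2
DIRECT on the pair `(K, K+n)`: direct matching at fixed infrared depth, uniformly in the gap) and `KingCurrencyTransport` (ne9's E-side
bracket re-cut + node U6's transport in the infrared-anchored currency), composed BY NAME; nothing new is estimated here.

THE ONE THEOREM `cauchySeq_genFun_of_pointwise`.  INPUTS — β-side: (P) for every box-valued reversed history `h` the sequence
`k ↦ D.βfun k (revHist h k)` is Cauchy (Bałaban's β-function HAS A LIMIT along every fixed coupling history as the cutoff is removed;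
NO rate, NO uniformity); (M) `HistLipschitz Λ γ β` with `FadingMemory C θ Λ`; the printed-type bound `|β| ≤ B`; the AF binders
`EventualLowerH b γ k₀ β` and the smallness `C((k₀+1)γ³ + 2γ∕b) ≤ (1−θ)∕2` of the consecutive kernel; the runs `K ↦ g^{(K)}` of
(0.20) pinned at one renormalized coupling ([Balaban1987RG1] Thm 2), lying in the E-side window `W`.  E-side ([King1986]'s
organisation, the ne9 seat's SHAPES of `Spine/NE9/DirectPairing`): the tower `F` (tower rate `C₅θ₅^m` = tower-NE5's one-step rate,
prefix dependence, separate uniform continuity per level, `|F| ≤ B_F`, window closed under shifts ∕ hybrids), transport `0 ≤ ρ < 1`,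
and node U5's King matching shape (the dressed partition functions of the runs `K` and `K + n` compared DIRECTLY, remainder = the
transported direct brackets).  OUTPUT: every `K ↦ genFun Z K s`, `|s| ≤ l₀`, is Cauchy and converges — `T4Assembly.GenFunCauchy`'s
content per source strength.  NE4 (`ScaleShiftRate`) appears NOWHERE.

PRIOR ART IN THE TREE (credit).  The pub-balaban NE7 #2 crux lineage's route «PAIR-CAUCHY» (`Support/NE7Pairwise*`, b2b-balaban-t4-ne7-p2
gens 48–49, 2026-08-21∕22) already runs node U2 on the cutoff pair with the rate-free n-layer scale-shift modulus: `NE7PairwiseScaleShift` (σ)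
is `KingCurrency.UniformShift` verbatim, `NE7PairwiseCouplingStep.discOff_step` is `KingCurrency.discAt_step`, and `NE7PairwiseMarginalBox` ∕
`NE7PairwiseCouplingDock.couplingGap_tendsto_zero` ∕ `NE7PairwiseCouplingUniform.couplingGap_uniform` give `KingCurrencyWindow.direct_matching_eventually`'s
conclusion; `NE7PairwiseOffsetEnd` has the pairwise apex.  What the (R51) chain adds: the Arzelà–Ascoli upgrade of `KingCurrencyPointwise`
((σ) from POINTWISE convergence along histories + the memory companion), the bridge to the ne9 seat's tower of `KingCurrencyTransport`,
the witness `KingCurrency.harmonicOsc`, and the composition below.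

HONEST FRAMING.  Composition of kernel theorems on hypothesis SHAPES (0 sorry, standard axioms); every β-side and E-side shape is an
UNPRINTED binder; nothing of Bałaban's is asserted or instantiated (NODE O 0∕1); NE4 ∕ (P) NOT IN PRINT; spine PROVED 0∕9 before and
after this file; rung (B)+1 on ONE finite T⁴ — NOT ℝ⁴, NOT infinite volume, NOT a mass gap, NOT Clay.

References (TYPES only): [Balaban1987RG1] = T. Bałaban, Commun. Math. Phys. **109** (1987) 249–301, (0.20) p. 256, Thm 2 p. 259, p. 264;
[King1986] = C. King, Commun. Math. Phys. **102** (1986) 649–677, Thm 3.4 (3.9) p. 656, (3.13) p. 657.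
-/

noncomputable section

namespace Summit.QuantumFields.BalabanUV.T4Continuum.Spine.NE4.KingCurrencyClosed

open Finset Filter Topology
open Literature.MathematicalPhysics.QuantumFieldTheory.Balaban1983to89
open Literature.MathematicalPhysics.QuantumFieldTheory.Balaban1983to89.FlowStep
open Literature.MathematicalPhysics.QuantumFieldTheory.Balaban1983to89.T4CouplingMatching
open Literature.MathematicalPhysics.QuantumFieldTheory.Balaban1983to89.T4BetaStationary
open T4CauchySum (genFun genFunLim)
open Summit.QuantumFields.BalabanUV.T4Continuum.Spine.NE4.KingCurrency
open Summit.QuantumFields.BalabanUV.T4Continuum.Spine.NE4.KingCurrencyWindow (direct_matching_eventually)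
open Summit.QuantumFields.BalabanUV.T4Continuum.Spine.NE4.KingCurrencyPointwise (exists_uniformShift_of_pointwise)
open Summit.QuantumFields.BalabanUV.T4Continuum.Spine.NE4.KingCurrencyTransport (cauchySeq_genFun_of_directMatching)

variable {W : Set (ℕ → ℝ)} {F : ℕ → (ℕ → ℝ) → ℝ}

/-- **THE (R51) CHAIN IN ONE THEOREM — rate-free β-side, King's route.**  See the module docstring for the input list.  Proof:
`exists_uniformShift_of_pointwise` (Arzelà–Ascoli) ⟶ `direct_matching_eventually` (node U2 direct, infrared-anchored fixed point) ⟶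
`cauchySeq_genFun_of_directMatching` (E-side bracket re-cut + node U6's transport + King's socket).  NE4's geometric rate is used nowhere.
A CONDITIONAL kernel theorem: none of its hypotheses is in print for Bałaban's d = 4 procedure. [cite: King1986, Thm 3.4 (3.9) p. 656 and (3.13) p. 657] -/
theorem cauchySeq_genFun_of_pointwise {β : HBeta} {γ b θ C B C₅ θ₅ B_F E ρ vol l₀ : ℝ} {Λ : ℕ → ℕ → ℝ} {k₀ : ℕ}
    {g : ℕ → ℕ → ℝ} {gIR : ℝ} {Z : ℕ → ℝ → ℝ}
    -- β-side: pointwise convergence along histories, the memory companion, the printed-type bound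
    (hγ : 0 < γ) (hθ0 : 0 < θ) (hθ1 : θ < 1)
    (hpt : ∀ h : ℕ → ℝ, SeqBox γ h → CauchySeq fun k => β k (revHist h k))
    (hL : HistLipschitz Λ γ β) (hΛ : FadingMemory C θ Λ)
    (hbd : ∀ k (v : Fin (k + 1) → ℝ), v ∈ Box γ k → |β k v| ≤ B)
    -- AF binders and the runs
    (hb : 0 < b) (hlo : EventualLowerH b γ k₀ β) (hsmall : C * (((k₀ : ℝ) + 1) * γ ^ 3 + 2 * γ / b) ≤ (1 - θ) / 2)
    (hrun : ∀ K, RGEqH K β (g K)) (hbox : ∀ K i, i ≤ K → 0 < g K i ∧ g K i ≤ γ) (hpin : ∀ K, g K K = gIR)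
    (hgW : ∀ K, g K ∈ W)
    -- E-side: the ne9 seat's tower shapes, transport, node U5's King matching shape
    (hC₅ : 0 ≤ C₅) (hθ₅0 : 0 ≤ θ₅) (hθ₅1 : θ₅ < 1)
    (hW : ∀ f ∈ W, (fun i => f (i + 1)) ∈ W)
    (hWmix : ∀ f ∈ W, ∀ f' ∈ W, ∀ a : ℕ, (fun i => if i < a then f' i else f i) ∈ W)
    (hT : ∀ m, ∀ f ∈ W, |F (m + 1) f - F m (fun i => f (i + 1))| ≤ C₅ * θ₅ ^ m)
    (hP : ∀ m, ∀ f ∈ W, ∀ f' ∈ W, (∀ i, i < m → f i = f' i) → F m f = F m f')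
    (hUC : ∀ m i : ℕ, i < m → ∀ ε : ℝ, 0 < ε → ∃ δ : ℝ, 0 < δ ∧ ∀ f ∈ W, ∀ f' ∈ W,
      (∀ k, k ≠ i → f k = f' k) → |f i - f' i| ≤ δ → |F m f - F m f'| ≤ ε)
    (hFb : ∀ m, ∀ f ∈ W, |F m f| ≤ B_F)
    (hE : 0 ≤ E) (hρ : 0 ≤ ρ) (hρ1 : ρ < 1) (hvol : 0 ≤ vol) (hl₀ : 0 ≤ l₀)
    (hU5 : ∀ K n : ℕ, ∃ c : ℝ, ∀ s : ℝ, |s| ≤ l₀ →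
      |Real.log (Z (K + n) s) - Real.log (Z K s) - c| ≤
        vol * (E * ∑ j ∈ range (K + 1), |F (j + n) (g (K + n)) - F j (g K)| * ρ ^ (K - j)))
    {s : ℝ} (hs : |s| ≤ l₀) :
    CauchySeq (fun K => genFun Z K s) ∧ Tendsto (fun K => genFun Z K s) atTop (𝓝 (genFunLim Z s)) := by
  have hC : 0 ≤ C := constant_nonneg_of_fadingMemory hΛ
  -- (P) + (M) + bound ⟹ the King-currency β-side input
  obtain ⟨ω, hω0, hωlim, hS⟩ := exists_uniformShift_of_pointwise hγ hθ0.le hθ1 hL hΛ hbd hpt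
  -- node U2 direct: matching at every fixed infrared depth, uniformly in the gap
  have hmatch := direct_matching_eventually g gIR hγ hb hθ0 hθ1 hC hrun hbox hpin hS hω0 hωlim hL hΛ hlo hsmall
  -- the E-side bracket re-cut + node U6's transport + King's socket
  exact cauchySeq_genFun_of_directMatching hC₅ hθ₅0 hθ₅1 hW hWmix hT hP hUC hFb hgW hmatch hE hρ hρ1 hvol hl₀ hU5 hs

end Summit.QuantumFields.BalabanUV.T4Continuum.Spine.NE4.KingCurrencyClosed
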